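import Literature.Topology.FourManifolds.DehnTwistFactorisation
import Literature.Topology.FourManifolds.AchiralLefschetzModel
import HarnessLib

/-!
# The Hurwitz–deletion (null) calculus on signed Dehn-twist words

Topic `Literature/Topology/FourManifolds`; a companion of `DehnTwistFactorisation.lean` (signed
letters `Letter P o = TwistCurve P o × Bool`, `monodromy`, Hurwitz moves `HurwitzStep`, global
conjugation `conjWord`, `Move`, `HurwitzEquivalent`) and `AchiralLefschetzModel.lean` (signed cycles
`SignedCycle P`, `AchiralLefschetz.wordInv`, the handlebody `X(P; w)` and the closed model
`X̂(P; w)`).  Definitions and PROVED lemmas only; nothing is asserted.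

## Content

* `toSigned`, `signedWord` — the bridge `Letter P o → SignedCycle P` (same annulus, core moved to
  height `0`, same sign) and its extension to words; `signedWord_letterInv`.
* `letterInv w = (w.map Letter.inv).reverse` — the inverse word `w̄` (the word of the upside-down
  handlebody: `X(P; a) ∪_∂ X̄(P; b)` is the closed model of `a ++ letterInv b`,
  Gompf–Stipsicz 1999 §8.4, Baykur 2006 §5); `letterInv_append`, `letterInv_letterInv`,
  `monodromy_letterInv : monodromy (letterInv w) = (monodromy w)⁻¹`.
* `Deletion w w'` — deletion of an ADJACENT MUTUALLY INVERSE PAIR `(c, ε)(d, ¬ε)` with `t_c = t_d`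
  (on the closed model: the inverse of one circle surgery, Gompf–Stipsicz 1999 §5.2/§8.4 — the
  4-manifold content is NOT asserted here); `NullStep` = a `Move` (either direction) or a
  `Deletion`; `IsHurwitzNull w` = `w` reduces to `[]` by null steps.  Hopf stabilisation is
  deliberately NOT a move (it changes the page; see `DehnTwistFactorisation.lean`, "Not here").
* Calculus: `letterInv`, `conjWord` and appending are compatible with `HurwitzStep`, `Move`,
  `Deletion`, `NullStep` as far as true (`HurwitzStep.letterInv`, `HurwitzStep.append_left/right`,
  `Move.letterInv`, `HurwitzEquivalent.letterInv`, `Deletion.letterInv`, `IsHurwitzNull.letterInv`);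
  `PureHurwitzEquivalent` (Hurwitz moves only, no global conjugation) IS a congruence for `++`
  (global conjugation is not: conjugating one half of `a ++ letterInv b` re-glues the model).
* Calibration (sorry-free): `isHurwitzNull_append_letterInv` (doubles `a · ā` are null with zero
  Hurwitz moves), `isHurwitzNull_pair`, nullity of `a ++ letterInv b` for `b` purely
  Hurwitz-equivalent to `a` (`isHurwitzNull_append_letterInv_of_pureHurwitzEquivalent`), invariance
  of nullity of `a ++ letterInv b` under pure Hurwitz moves of `b` alone and under SIMULTANEOUS
  global conjugation of `a` and `b`; `IsHurwitzNull.symm` (`a·b̄` null iff `b·ā` null);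
  `IsHurwitzNull.monodromy_eq_one`, `IsHurwitzNull.even_length`.

Used by the line `hurwitz-deletion-presentation` of crux `ConvexBisection.AcyclicBisectionRigidity`
(stmt-SmoothPoincare4-10507), whose apex asserts `IsHurwitzNull (a ++ letterInv b)` for
connected-binding homotopy-sphere two-factorisation words.

## References

* R. E. Gompf, A. I. Stipsicz, *4-Manifolds and Kirby Calculus*, GSM 20 (1999), §5.2, §8.2, §8.4.
  [GompfStipsiczGSM1999]
* D. Auroux, *A stable classification of Lefschetz fibrations*, Geom. Topol. 9 (2005), §2.
  [Auroux2005]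
* R. İ. Baykur, *Kähler decomposition of 4-manifolds*, AGT 6 (2006), §5. [Baykur2006]
-/

open scoped Manifold ContDiff Topology
open Set Function

noncomputable section

namespace Literature.Topology.FourManifolds

section Calculus

variable {P : Type*} [TopologicalSpace P] [T2Space P] [ChartedSpace (EuclideanHalfSpace 2) P]
  [IsManifold (𝓡∂ 2) ∞ P] {o : SmoothOrientation (𝓡∂ 2) P}

/-! ### Letters as signed cycles; the inverse word -/

/-- **Letter ↦ signed cycle.** The tree has two renderings of a signed vanishing cycle: the
`Letter P o = TwistCurve P o × Bool` of the Hurwitz calculus (`DehnTwistFactorisation.lean`; the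
curve is the core `u ↦ c (u, 1/2)` of an oriented twisting annulus) and the `SignedCycle P` of the
handlebody vocabulary (`AchiralLefschetzModel.lean`; the curve is `x ↦ annulus (x, 0)`). This is the
bridge: the same annulus re-parametrised so that height `0` is the core, same sign. [folklore] -/
def toSigned (x : Letter P o) : SignedCycle P :=
  ⟨fun q => x.1.toFun (q.1, q.2 + 1 / 2), x.2⟩

/-- The signed-cycle word of a word of letters. [folklore] -/
def signedWord (w : List (Letter P o)) : List (SignedCycle P) :=
  w.map toSigned

/-- **The inverse word `w̄`** on letters: reverse the order, flip every sign — the word of the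
upside-down handlebody, so that `X(P; a) ∪_∂ X̄(P; b)` is the closed model of `a ++ letterInv b`
(Gompf–Stipsicz 1999 §8.4; Baykur 2006 §5; tree `AchiralLefschetz.wordInv` on signed cycles).
[cite: GompfStipsiczGSM1999, §8.4] -/
def letterInv (w : List (Letter P o)) : List (Letter P o) :=
  (w.map Letter.inv).reverse

omit [T2Space P] in
/-- `toSigned` intertwines the two sign flips. [folklore] -/
@[simp] theorem toSigned_inv (x : Letter P o) : toSigned x.inv = (toSigned x).bar := rfl

omit [T2Space P] in
/-- The signed word of the inverse word is the inverse signed word. [folklore] -/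
theorem signedWord_letterInv (w : List (Letter P o)) :
    signedWord (letterInv w) = AchiralLefschetz.wordInv (signedWord w) := by
  simp [signedWord, letterInv, AchiralLefschetz.wordInv, List.map_reverse, Function.comp_def]

omit [T2Space P] in
/-- `letterInv [] = []`. [folklore] -/
@[simp] theorem letterInv_nil : letterInv ([] : List (Letter P o)) = [] := rfl

omit [T2Space P] in
/-- `letterInv` of a cons. [folklore] -/
theorem letterInv_cons (x : Letter P o) (w : List (Letter P o)) :
    letterInv (x :: w) = letterInv w ++ [x.inv] := by
  simp [letterInv]

omit [T2Space P] in
/-- `letterInv` of a snoc. [folklore] -/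
theorem letterInv_append_singleton (a : List (Letter P o)) (x : Letter P o) :
    letterInv (a ++ [x]) = x.inv :: letterInv a := by
  simp [letterInv]

omit [T2Space P] in
/-- `letterInv` is an anti-homomorphism for `++`. [folklore] -/
theorem letterInv_append (a b : List (Letter P o)) :
    letterInv (a ++ b) = letterInv b ++ letterInv a := by
  simp [letterInv, List.map_append, List.reverse_append]

omit [T2Space P] in
/-- `letterInv` is an involution. [folklore] -/
@[simp] theorem letterInv_letterInv (w : List (Letter P o)) : letterInv (letterInv w) = w := by
  simp [letterInv, List.map_reverse, Function.comp_def]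

omit [T2Space P] in
/-- `letterInv` preserves length. [folklore] -/
@[simp] theorem length_letterInv (w : List (Letter P o)) : (letterInv w).length = w.length := by
  simp [letterInv]

omit [T2Space P] in
/-- Membership in `letterInv w`. [folklore] -/
theorem mem_letterInv {w : List (Letter P o)} {x : Letter P o} :
    x ∈ letterInv w ↔ x.inv ∈ w := by
  constructor
  · intro hx
    obtain ⟨y, hy, rfl⟩ := List.mem_map.1 (List.mem_reverse.1 hx)
    simpa using hy
  · intro hx
    exact List.mem_reverse.2 (List.mem_map.2 ⟨x.inv, hx, by simp⟩)

/-- **`monodromy w̄ = (monodromy w)⁻¹`.** [folklore] -/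
theorem monodromy_letterInv (w : List (Letter P o)) :
    monodromy (letterInv w) = (monodromy w)⁻¹ := by
  induction w with
  | nil => simp
  | cons x w ih =>
    rw [letterInv_cons, monodromy_append, ih, monodromy_cons, monodromy_cons, monodromy_nil,
      mul_one, Letter.toClass_inv, mul_inv_rev]

/-- A two-factorisation word `a ++ letterInv b` of two words with the same monodromy is a
factorisation of the identity. [folklore] -/
theorem monodromy_append_letterInv_eq_one {a b : List (Letter P o)}
    (h : monodromy a = monodromy b) : monodromy (a ++ letterInv b) = 1 := by
  rw [monodromy_append, monodromy_letterInv, h, mul_inv_cancel]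

/-! ### Deletions, null steps, Hurwitz-null words -/

/-- **DELETION of an adjacent mutually inverse pair.** `w = pre · (c, ε) · (d, ¬ε) · suf ↦ pre · suf`
whenever `t_c = t_d` in `Mod(P, ∂P)`. On the closed model this is the INVERSE OF A CIRCLE SURGERY
(`X̂(P; pre c^ε c^{-ε} suf)` is `X̂(P; pre suf)` surgered along `c` pushed into a fibre: the two
2-handles along parallel copies of `c` with framings `pf - ε`, `pf + ε` slide to `{c, μ_c⁰}`,
Gompf–Stipsicz 1999 §5.2, §8.4); that 4-manifold content is NOT asserted here.
[cite: GompfStipsiczGSM1999, §8.4] -/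
def Deletion (w w' : List (Letter P o)) : Prop :=
  ∃ (pre suf : List (Letter P o)) (c d : TwistCurve P o) (ε : Bool),
    w = pre ++ (c, ε) :: (d, !ε) :: suf ∧ c.twist = d.twist ∧ w' = pre ++ suf

/-- One step of the null calculus: a Hurwitz move / global conjugation (`Move`, either direction)
or a deletion. Positive (Hopf) stabilisation is deliberately absent. [folklore] -/
def NullStep (w w' : List (Letter P o)) : Prop :=
  Move w w' ∨ Move w' w ∨ Deletion w w'

/-- **Hurwitz-null words**: reducible to the empty word by Hurwitz moves, global conjugations and
deletions of adjacent mutually inverse pairs. [folklore] -/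
def IsHurwitzNull (w : List (Letter P o)) : Prop :=
  Relation.ReflTransGen NullStep w []

/-- The empty word is null. [folklore] -/
theorem isHurwitzNull_nil : IsHurwitzNull ([] : List (Letter P o)) :=
  Relation.ReflTransGen.refl

/-- A null step followed by a null reduction is a null reduction. [folklore] -/
theorem IsHurwitzNull.head {w w' : List (Letter P o)} (h : NullStep w w') (h' : IsHurwitzNull w') :
    IsHurwitzNull w :=
  Relation.ReflTransGen.head h h'

/-- A null reduction of `w'` preceded by null steps from `w` to `w'`. [folklore] -/
theorem IsHurwitzNull.of_reflTransGen {w w' : List (Letter P o)}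
    (h : Relation.ReflTransGen NullStep w w') (h' : IsHurwitzNull w') : IsHurwitzNull w :=
  Relation.ReflTransGen.trans h h'

/-- Hurwitz-equivalent words are null together (the calculus contains `Move` in both
directions). [folklore] -/
theorem IsHurwitzNull.of_hurwitzEquivalent {w w' : List (Letter P o)} (h : HurwitzEquivalent w w')
    (h' : IsHurwitzNull w') : IsHurwitzNull w := by
  unfold HurwitzEquivalent at h
  induction h with
  | refl => exact h'
  | tail _ hbc ih =>
    refine ih (Relation.ReflTransGen.head ?_ h')
    rcases hbc with hbc | hbc
    · exact Or.inl hbc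
    · exact Or.inr (Or.inl hbc)

/-- Nullity is invariant under Hurwitz equivalence. [folklore] -/
theorem HurwitzEquivalent.isHurwitzNull_iff {w w' : List (Letter P o)} (h : HurwitzEquivalent w w') :
    IsHurwitzNull w ↔ IsHurwitzNull w' :=
  ⟨fun hw => IsHurwitzNull.of_hurwitzEquivalent h.symm hw, fun hw' => hw'.of_hurwitzEquivalent h⟩

/-- **A deletion does not change the monodromy** (`t_c^{ε} t_c^{-ε} = 1`). [folklore] -/
theorem Deletion.monodromy_eq {w w' : List (Letter P o)} (h : Deletion w w') :
    monodromy w' = monodromy w := by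
  obtain ⟨pre, suf, c, d, ε, rfl, hcd, rfl⟩ := h
  simp only [monodromy_append, monodromy_cons]
  have : Letter.toClass (c, ε) * Letter.toClass (d, !ε) = 1 := by
    cases ε
    · simp [Letter.toClass_false, Letter.toClass_true, hcd]
    · simp [Letter.toClass_false, Letter.toClass_true, hcd]
  rw [← mul_assoc (Letter.toClass (c, ε)), this, one_mul]

/-- A null step changes the monodromy by a conjugation. [folklore] -/
theorem NullStep.exists_monodromy_eq {w w' : List (Letter P o)} (h : NullStep w w') :
    ∃ g : MappingClassGroupRelBoundary (𝓡∂ 2) P, monodromy w' = g * monodromy w * g⁻¹ := by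
  rcases h with h | h | h
  · exact h.exists_monodromy_eq
  · obtain ⟨g, hg⟩ := h.exists_monodromy_eq
    exact ⟨g⁻¹, by rw [hg]; group⟩
  · exact ⟨1, by rw [h.monodromy_eq]; group⟩

/-- **A null word is a factorisation of the identity.** [folklore] -/
theorem IsHurwitzNull.monodromy_eq_one {w : List (Letter P o)} (h : IsHurwitzNull w) :
    monodromy w = 1 := by
  unfold IsHurwitzNull at h
  induction h using Relation.ReflTransGen.head_induction_on with
  | refl => simp
  | head hst _ ih =>
    obtain ⟨g, hg⟩ := hst.exists_monodromy_eq
    rw [ih] at hg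
    -- 1 = g * m * g⁻¹  ⇒  m = 1
    have : g⁻¹ * 1 * g = _ := congrArg (fun z => g⁻¹ * z * g) hg
    simpa [mul_assoc] using this.symm

/-- A Hurwitz step preserves length. [folklore] -/
theorem HurwitzStep.length_eq {w w' : List (Letter P o)} (h : HurwitzStep w w') :
    w'.length = w.length := by
  obtain ⟨pre, suf, x, y, rfl, rfl | rfl⟩ := h <;> simp

/-- A move preserves length. [folklore] -/
theorem Move.length_eq {w w' : List (Letter P o)} (h : Move w w') : w'.length = w.length := by
  cases h with
  | hurwitz h => exact h.length_eq
  | conj g hg w => simp [conjWord]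

/-- A deletion shortens the word by two. [folklore] -/
theorem Deletion.length_eq {w w' : List (Letter P o)} (h : Deletion w w') :
    w.length = w'.length + 2 := by
  obtain ⟨pre, suf, c, d, ε, rfl, -, rfl⟩ := h
  simp; omega

/-- **Null words have even length** (each deletion removes two letters, moves preserve length).
[folklore] -/
theorem IsHurwitzNull.even_length {w : List (Letter P o)} (h : IsHurwitzNull w) : Even w.length := by
  unfold IsHurwitzNull at h
  induction h using Relation.ReflTransGen.head_induction_on with
  | refl => simp
  | head hst _ ih =>
    rcases hst with hm | hm | hd
    · rwa [← hm.length_eq]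
    · rwa [hm.length_eq]
    · rw [hd.length_eq]; exact ih.add (by decide)

/-! ### Calibration: doubles and pairs -/

/-- **The double sector is null with zero Hurwitz moves.** For EVERY word `a` the double word
`a · ā` (closed model = the double `D(X(P; a))`) reduces to `[]` by `|a|` successive deletions of
the innermost pair. [folklore] -/
theorem isHurwitzNull_append_letterInv (a : List (Letter P o)) : IsHurwitzNull (a ++ letterInv a) := by
  induction a using List.reverseRecOn with
  | nil => exact isHurwitzNull_nil
  | append_singleton a' x ih =>
    obtain ⟨c, ε⟩ := x
    have hstep : NullStep ((a' ++ [(c, ε)]) ++ letterInv (a' ++ [(c, ε)])) (a' ++ letterInv a') := by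
      refine Or.inr (Or.inr ⟨a', letterInv a', c, c, ε, ?_, rfl, rfl⟩)
      rw [letterInv_append_singleton]
      simp [Letter.inv]
    exact IsHurwitzNull.head hstep ih

/-- A single mutually inverse pair is null. [folklore] -/
theorem isHurwitzNull_pair (c : TwistCurve P o) (ε : Bool) : IsHurwitzNull [(c, ε), (c, !ε)] := by
  simpa [letterInv, Letter.inv] using isHurwitzNull_append_letterInv [(c, ε)]

/-! ### Compatibility of the moves with `++`, `letterInv` and `conjWord` -/

/-- Hurwitz steps are local: they survive appending on the left. [folklore] -/
theorem HurwitzStep.append_left {w w' : List (Letter P o)} (h : HurwitzStep w w') (a : List (Letter P o)) :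
    HurwitzStep (a ++ w) (a ++ w') := by
  obtain ⟨pre, suf, x, y, rfl, rfl | rfl⟩ := h
  · exact ⟨a ++ pre, suf, x, y, by simp, Or.inl (by simp)⟩
  · exact ⟨a ++ pre, suf, x, y, by simp, Or.inr (by simp)⟩

/-- Hurwitz steps are local: they survive appending on the right. [folklore] -/
theorem HurwitzStep.append_right {w w' : List (Letter P o)} (h : HurwitzStep w w') (b : List (Letter P o)) :
    HurwitzStep (w ++ b) (w' ++ b) := by
  obtain ⟨pre, suf, x, y, rfl, rfl | rfl⟩ := h
  · exact ⟨pre, suf ++ b, x, y, by simp, Or.inl (by simp)⟩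
  · exact ⟨pre, suf ++ b, x, y, by simp, Or.inr (by simp)⟩

/-- **Hurwitz steps pass to the inverse word**: the image of the step `(x, y) ↦ (t_x^{ε}(y), x)`
under `w ↦ w̄` is the inverse step `(ȳ, x̄) ↦ (x̄, t_x^{ε}(y)‾)` and vice versa. [folklore] -/
theorem HurwitzStep.letterInv {w w' : List (Letter P o)} (h : HurwitzStep w w') :
    HurwitzStep (FourManifolds.letterInv w) (FourManifolds.letterInv w') := by
  obtain ⟨pre, suf, x, y, rfl, rfl | rfl⟩ := h
  · refine ⟨FourManifolds.letterInv suf, FourManifolds.letterInv pre, y.inv, x.inv, ?_, Or.inr ?_⟩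
    · simp [letterInv_append, letterInv_cons]
    · simp [letterInv_append, letterInv_cons, Letter.inv, Letter.act]
  · refine ⟨FourManifolds.letterInv suf, FourManifolds.letterInv pre, y.inv, x.inv, ?_, Or.inl ?_⟩
    · simp [letterInv_append, letterInv_cons]
    · simp [letterInv_append, letterInv_cons, Letter.inv, Letter.act]

omit [T2Space P] in
/-- Global conjugation commutes with `letterInv`. [folklore] -/
theorem conjWord_letterInv (g : DiffRelBoundary (𝓡∂ 2) P)
    (hg : g ∈ RelDiffeo.orientedSubgroup ((𝓡∂ 2).boundary P) o) (w : List (Letter P o)) :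
    conjWord g hg (letterInv w) = letterInv (conjWord g hg w) := by
  simp [conjWord, letterInv, List.map_reverse, Function.comp_def, Letter.inv]

omit [T2Space P] in
/-- Global conjugation is letterwise, hence compatible with `++`. [folklore] -/
theorem conjWord_append (g : DiffRelBoundary (𝓡∂ 2) P)
    (hg : g ∈ RelDiffeo.orientedSubgroup ((𝓡∂ 2).boundary P) o) (a b : List (Letter P o)) :
    conjWord g hg (a ++ b) = conjWord g hg a ++ conjWord g hg b := by
  simp [conjWord]

/-- **Moves pass to the inverse word.** [folklore] -/
theorem Move.letterInv {w w' : List (Letter P o)} (h : Move w w') :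
    Move (FourManifolds.letterInv w) (FourManifolds.letterInv w') := by
  cases h with
  | hurwitz h => exact Move.hurwitz h.letterInv
  | conj g hg w => rw [← conjWord_letterInv]; exact Move.conj g hg _

/-- **Hurwitz equivalence passes to the inverse word.** [folklore] -/
theorem HurwitzEquivalent.letterInv {w w' : List (Letter P o)} (h : HurwitzEquivalent w w') :
    HurwitzEquivalent (FourManifolds.letterInv w) (FourManifolds.letterInv w') := by
  unfold HurwitzEquivalent at h ⊢
  induction h with
  | refl => exact Relation.ReflTransGen.refl
  | tail _ hbc ih =>
    refine Relation.ReflTransGen.tail ih ?_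
    rcases hbc with hbc | hbc
    · exact Or.inl hbc.letterInv
    · exact Or.inr hbc.letterInv

/-- **Deletions pass to the inverse word** (the pair `(c, ε)(d, ¬ε)` becomes `(d, ε)(c, ¬ε)`).
[folklore] -/
theorem Deletion.letterInv {w w' : List (Letter P o)} (h : Deletion w w') :
    Deletion (FourManifolds.letterInv w) (FourManifolds.letterInv w') := by
  obtain ⟨pre, suf, c, d, ε, rfl, hcd, rfl⟩ := h
  refine ⟨FourManifolds.letterInv suf, FourManifolds.letterInv pre, d, c, ε, ?_, hcd.symm, ?_⟩
  · simp [letterInv_append, letterInv_cons, Letter.inv]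
  · simp [letterInv_append]

/-- Deletions are local: appending on the left. [folklore] -/
theorem Deletion.append_left {w w' : List (Letter P o)} (h : Deletion w w') (a : List (Letter P o)) :
    Deletion (a ++ w) (a ++ w') := by
  obtain ⟨pre, suf, c, d, ε, rfl, hcd, rfl⟩ := h
  exact ⟨a ++ pre, suf, c, d, ε, by simp, hcd, by simp⟩

/-- Deletions are local: appending on the right. [folklore] -/
theorem Deletion.append_right {w w' : List (Letter P o)} (h : Deletion w w') (b : List (Letter P o)) :
    Deletion (w ++ b) (w' ++ b) := by
  obtain ⟨pre, suf, c, d, ε, rfl, hcd, rfl⟩ := h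
  exact ⟨pre, suf ++ b, c, d, ε, by simp, hcd, by simp⟩

/-- **Null steps pass to the inverse word.** [folklore] -/
theorem NullStep.letterInv {w w' : List (Letter P o)} (h : NullStep w w') :
    NullStep (FourManifolds.letterInv w) (FourManifolds.letterInv w') := by
  rcases h with h | h | h
  · exact Or.inl h.letterInv
  · exact Or.inr (Or.inl h.letterInv)
  · exact Or.inr (Or.inr h.letterInv)

/-- **Nullity passes to the inverse word.** [folklore] -/
theorem IsHurwitzNull.letterInv {w : List (Letter P o)} (h : IsHurwitzNull w) :
    IsHurwitzNull (FourManifolds.letterInv w) := by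
  unfold IsHurwitzNull at h ⊢
  induction h using Relation.ReflTransGen.head_induction_on with
  | refl => exact Relation.ReflTransGen.refl
  | head hst _ ih => exact Relation.ReflTransGen.head hst.letterInv ih

/-- Nullity of `w` and of `w̄` are equivalent. [folklore] -/
theorem isHurwitzNull_letterInv_iff (w : List (Letter P o)) :
    IsHurwitzNull (letterInv w) ↔ IsHurwitzNull w :=
  ⟨fun h => by simpa using h.letterInv, IsHurwitzNull.letterInv⟩

/-- **Symmetry of the two-factorisation nullity problem**: `a · b̄` is null iff `b · ā` is (the
closed models are each other's orientation reversals). [folklore] -/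
theorem IsHurwitzNull.symm {a b : List (Letter P o)} (h : IsHurwitzNull (a ++ FourManifolds.letterInv b)) :
    IsHurwitzNull (b ++ FourManifolds.letterInv a) := by
  simpa [letterInv_append] using h.letterInv

/-! ### Pure Hurwitz equivalence (no global conjugation) is a congruence -/

/-- **Pure Hurwitz equivalence**: the equivalence generated by Hurwitz steps alone (no global
conjugation) — Auroux's "Hurwitz equivalent" in the strict sense; the braid-group orbit.
[cite: Auroux2005, §2 Def. 5] -/
def PureHurwitzEquivalent : List (Letter P o) → List (Letter P o) → Prop :=
  Relation.ReflTransGen fun w w' => HurwitzStep w w' ∨ HurwitzStep w' w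

/-- Pure Hurwitz equivalence is reflexive. [folklore] -/
theorem PureHurwitzEquivalent.refl (w : List (Letter P o)) : PureHurwitzEquivalent w w :=
  Relation.ReflTransGen.refl

/-- A Hurwitz step is a pure Hurwitz equivalence. [folklore] -/
theorem HurwitzStep.pureHurwitzEquivalent {w w' : List (Letter P o)} (h : HurwitzStep w w') :
    PureHurwitzEquivalent w w' :=
  Relation.ReflTransGen.single (Or.inl h)

/-- Pure Hurwitz equivalence is symmetric. [folklore] -/
theorem PureHurwitzEquivalent.symm {w w' : List (Letter P o)} (h : PureHurwitzEquivalent w w') :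
    PureHurwitzEquivalent w' w := by
  unfold PureHurwitzEquivalent at h ⊢
  induction h with
  | refl => exact Relation.ReflTransGen.refl
  | tail _ hbc ih => exact Relation.ReflTransGen.head hbc.symm ih

/-- Pure Hurwitz equivalence is transitive. [folklore] -/
theorem PureHurwitzEquivalent.trans {w w' w'' : List (Letter P o)} (h : PureHurwitzEquivalent w w')
    (h' : PureHurwitzEquivalent w' w'') : PureHurwitzEquivalent w w'' :=
  Relation.ReflTransGen.trans h h'

/-- Pure Hurwitz equivalence implies Hurwitz equivalence. [folklore] -/
theorem PureHurwitzEquivalent.hurwitzEquivalent {w w' : List (Letter P o)}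
    (h : PureHurwitzEquivalent w w') : HurwitzEquivalent w w' := by
  unfold PureHurwitzEquivalent at h
  induction h with
  | refl => exact HurwitzEquivalent.refl _
  | tail _ hbc ih =>
    refine ih.trans (Relation.ReflTransGen.single ?_)
    rcases hbc with hbc | hbc
    · exact Or.inl (Move.hurwitz hbc)
    · exact Or.inr (Move.hurwitz hbc)

/-- **Pure Hurwitz equivalence is a congruence for `++`** (Hurwitz steps are local). [folklore] -/
theorem PureHurwitzEquivalent.append {a a' b b' : List (Letter P o)} (ha : PureHurwitzEquivalent a a')
    (hb : PureHurwitzEquivalent b b') : PureHurwitzEquivalent (a ++ b) (a' ++ b') := by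
  have h1 : PureHurwitzEquivalent (a ++ b) (a' ++ b) := by
    unfold PureHurwitzEquivalent at ha ⊢
    induction ha with
    | refl => exact Relation.ReflTransGen.refl
    | tail _ hbc ih =>
      refine Relation.ReflTransGen.tail ih ?_
      rcases hbc with hbc | hbc
      · exact Or.inl (hbc.append_right b)
      · exact Or.inr (hbc.append_right b)
  have h2 : PureHurwitzEquivalent (a' ++ b) (a' ++ b') := by
    unfold PureHurwitzEquivalent at hb ⊢
    induction hb with
    | refl => exact Relation.ReflTransGen.refl
    | tail _ hbc ih =>
      refine Relation.ReflTransGen.tail ih ?_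
      rcases hbc with hbc | hbc
      · exact Or.inl (hbc.append_left a')
      · exact Or.inr (hbc.append_left a')
  exact h1.trans h2

/-- Pure Hurwitz equivalence passes to the inverse word. [folklore] -/
theorem PureHurwitzEquivalent.letterInv {w w' : List (Letter P o)} (h : PureHurwitzEquivalent w w') :
    PureHurwitzEquivalent (FourManifolds.letterInv w) (FourManifolds.letterInv w') := by
  unfold PureHurwitzEquivalent at h ⊢
  induction h with
  | refl => exact Relation.ReflTransGen.refl
  | tail _ hbc ih =>
    refine Relation.ReflTransGen.tail ih ?_
    rcases hbc with hbc | hbc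
    · exact Or.inl hbc.letterInv
    · exact Or.inr hbc.letterInv

/-- **Nullity of `a · b̄` is invariant under pure Hurwitz moves of `a` and of `b` separately**
(re-choosing the Hurwitz arc systems of the two halves re-reads the same glued manifold).
[folklore] -/
theorem isHurwitzNull_append_letterInv_iff {a a' b b' : List (Letter P o)}
    (ha : PureHurwitzEquivalent a a') (hb : PureHurwitzEquivalent b b') :
    IsHurwitzNull (a ++ letterInv b) ↔ IsHurwitzNull (a' ++ letterInv b') :=
  (ha.append hb.letterInv).hurwitzEquivalent.isHurwitzNull_iff

/-- **The purely-Hurwitz-equivalent sector is null**: if `b` is obtained from `a` by Hurwitz moves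
alone then `a · b̄` is null (move `b̄` back to `ā`, then delete innermost pairs). [folklore] -/
theorem isHurwitzNull_append_letterInv_of_pureHurwitzEquivalent {a b : List (Letter P o)}
    (h : PureHurwitzEquivalent a b) : IsHurwitzNull (a ++ letterInv b) :=
  (isHurwitzNull_append_letterInv_iff (PureHurwitzEquivalent.refl a) h).1
    (isHurwitzNull_append_letterInv a)

/-- **Simultaneous global conjugation of both halves preserves nullity** (it is ONE global
conjugation of the two-factorisation word; conjugating only one half is a different gluing and is
NOT covered). [folklore] -/
theorem isHurwitzNull_conjWord_append_letterInv_iff (g : DiffRelBoundary (𝓡∂ 2) P)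
    (hg : g ∈ RelDiffeo.orientedSubgroup ((𝓡∂ 2).boundary P) o) (a b : List (Letter P o)) :
    IsHurwitzNull (conjWord g hg a ++ letterInv (conjWord g hg b)) ↔ IsHurwitzNull (a ++ letterInv b) := by
  rw [← conjWord_letterInv, ← conjWord_append]
  exact ((Move.conj g hg (a ++ letterInv b)).hurwitzEquivalent.isHurwitzNull_iff).symm

end Calculus

end Literature.Topology.FourManifolds

end
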